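import Literature.MathematicalPhysics.QuantumFieldTheory.Balaban1983to89.B5Leaf237C0Torus

/-!
# (1.15) of Bałaban [4] ON THE TORUS: `γ₀I ≤ Δ^{(j)} + aL^{−2}Q^*Q ≤ γ₁I` for the argument of the rescaled
# covariance `C^{(j)}` of the concrete scalar torus tower, uniformly in the level

B4 = [4] = T. Bałaban, *Regularity and decay of lattice Green's functions*, Commun. Math. Phys. **89** (1983)
571–597 [cite: Balaban1983RegularityDecay]; B1 = [1] = *(Higgs)₂,₃ quantum fields in a finite volume I*, Commun.
Math. Phys. **85** (1982) 603–636 [cite: Balaban1982Higgs1]; B5 = *Propagators and renormalization transformations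
for lattice gauge theories. I*, Commun. Math. Phys. **95** (1984) 17–40 [cite: Balaban1984PropagatorsI].
Cell records: GAPS G-pv07-5 residue (R3) (the located leaf `B5Ineq137.Leaf235to237` of `B5Ineq137Torus`, conjunct
K2 = the entries of `B5Display136Torus.Crs`, `K2_eq`), this module = node G-pv07-5e (b2b-balaban-pv07-g7),
certification C-pv07-26, DIVERGENCE D-pv07.19; v1.2 = DOCFIX only (XREAD C-pv15g5-3 D1: the B5 title line;
GAPS C-pv07-30).  value = kernel certificate for a by-reference step, NOT summit
progress.

## The printed step

* B4 p. 574 [PDF 4]: *"Proposition 2.3 of [1]. There exist positive constants δ₀, c₀, γ₀, γ₁ dependent on d and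
  M only and such that for arbitrary Λ ⊂ Ω^{(k)} = Ω∩Z^d, Λ being a sum of big blocks and for e sufficiently small,
  we have γ₀I ≤ Δ^{(k)}(Ω, A) + aL^{−2}P(A) ≤ γ₁I, (1.15) |C^{(k)}_Λ(Ω, A; x, x′)| ≤ c₀ exp(−δ₀|x − x′|), x, x′ ∈ Λ.
  (1.16)"*; same page: *"The fifth section will be devoted to a general theorem concerning operators on the unit
  lattice Z^d. There we have abstracted some basic features of our method and we have proven a theorem which, if
  applied to operators (1.14), gives another proof of Proposition 2.3."*
* B1 p. 610 [PDF 8]: *"Defining the propagator G^ε_k(Ω, A) = (−Δ^{ε,N}_{A,Ω} + m² + a_k(L^kε)^{−2}P_k(A))^{−1},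
  P_k(A) = Q^*_k(A)Q_k(A), (2.20) and calculating the integral in (2.19), we obtain ⟨ψ, Δ^{(k),L^kε}(Ω, A)ψ⟩ =
  a_k(L^kε)^{−2}⟨ψ, ψ⟩ − a_k²(L^kε)^{−4}⟨ψ, Q_k(A)G^ε_k(Ω, A)Q^*_k(A)ψ⟩. (2.21) In the sequel the properties of the
  propagator G^ε_k(Ω, A) rescaled to the η-lattice, η = L^{−k}, will be very important. Let us notice that the
  rescaled propagator is given by G_k(Ω, A) = (−Δ^{η,N}_{A,Ω} + m²(L^kε)² + a_kP_k(A))^{−1}. (2.22)"*, where (2.19)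
  is the Gaussian integral *"Z^ε_k(Ω, A) exp(−½⟨ψ, Δ^{(k),L^kε}(Ω, A)ψ⟩) = T^ε_{a_k,L^k,A}[Ω, exp(−½⟨φ, (−Δ^{ε,N}_{A,Ω}
  + m²)φ⟩)]"*.
* B1 p. 611 [PDF 9]: *"In the sequel we will use the covariance rescaled to the unit lattice and it is of the form
  C^{(k)}(Ω, A) = (aL^{−2}P(A) + Δ^{(k)}(Ω, A))^{−1}. (2.31)"* (quoted in `B5Display136Torus.Crs`).
* B4 p. 580 [PDF 10], the coercivity mechanism: *"(2.26) … The operator −Δ^{η,N}_Δ is bounded from below by π² on a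
  subspace of functions on Δ orthogonal to constant functions, which are its eigenvectors corresponding to
  eigenvalue 0. The operator P_k is an orthogonal projection on a subspace of constant functions, thus
  ⟨φ,(−Δ^{η,N}_Δ + a_kP_k)φ⟩ ≥ min{π², a_k}‖φ‖_{L²(Δ)}, (2.27)"* — i.e. the block operator −Δ^{η,N}_Δ + a_kP_k is
  bounded below by min{π², a_k} (our paraphrase); on the torus, summed over blocks, with the repaired constant `8`:
  `B5Leaf237C0Torus.block_poincare` (from `B4Block227.block227_real`, b04 lineage).

## What this file proves (U = 1, Ω = Λ = the whole torus, mass m² ≥ 0, a > 0, every level j ≥ 1)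

For Bałaban's concrete scalar torus tower `B1RG242Torus.tower P a msq` and its rescaled objects of
`B5Display136Torus` — `Grs P a msq j` = (2.22), `Drs P a msq j` = Δ^{(j)} of (2.21) on the unit lattice T₁^{(j)} =
`Site P j`, `Crs P a msq j = (aL^{−2}·Q^*Q + Drs)^{−1}` = (2.31) — with `Marg` := the argument of `Grs` and `Carg` :=
the argument of `Crs` (`Grs_eq`, `Crs_eq`: definitional):
* §1 block-averaging algebra: `⟨Q_wφ, θ⟩ = w⟨φ, Q^*θ⟩` (`avg_dot_eq`), `⟨φ, Q^*Q_wφ⟩ = w^{−1}‖Q_wφ‖²` (`form_EA`),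
  Jensen `‖Q_wφ‖² ≤ w‖φ‖²` for `w = L^{−ed}` (`avg_sq_le`);
* §2 **`Marg_coercive`**: `min{8, a_j}·‖φ‖² ≤ ⟨φ, (−Δ^{L^{−j}} + (L^jε)²m² + a_jQ^*_jQ_j)φ⟩` (block Poincaré on the
  fine torus with the L^j-blocks), hence `Marg` is a genuine inverse (`Marg_isUnit`, `Marg_mul_Grs`, `Grs_mul_Marg`)
  and `Grs` is positive semi-definite (`Grs_form_nonneg`) — an independent proof of B1's *"It is so"* (p. 611) for
  G_j, cf. `B1RG242Torus.G_arg`;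
* §3 **the variational identity** behind (2.19)–(2.21) (`form_Drs`): with `φ₀ = a_jG_jQ^*_jψ` (`phi0`),
  `⟨ψ, Δ^{(j)}ψ⟩ = L^{−jd}⟨φ₀, (−Δ^{L^{−j}} + (L^jε)²m²)φ₀⟩ + a_j‖Q_jφ₀ − ψ‖²` — pure matrix algebra from
  `Marg·Grs = 1`; corollaries `0 ≤ ⟨ψ, Δ^{(j)}ψ⟩ ≤ a_j‖ψ‖²` (`form_Drs_nonneg`, `form_Drs_le`);
* §4 **(1.15) ON THE TORUS** (`ineq115_lower`, `ineq115_upper`, `ineq115`):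
  `γ₀(L, a, a_j)·‖ψ‖² ≤ ⟨ψ, (aL^{−2}Q^*Q + Δ^{(j)})ψ⟩ ≤ (a + aL^{−2})·‖ψ‖²` with the EXPLICIT
  `γ₀ = gamma115 L a a_j = ((4L² + 4a/a_j)/min{8, a} + 2/a_j)^{−1}`, and the level-free constant
  `gamma115u L a` via `a(1 − L^{−2}) < a_j ≤ a` (`ineq115_lower_uniform`); packaged as the first two clauses of
  `B4Sect5Torus.Hyp56` for `A = Carg` (`Carg_isSymm` — with `Grs_isSymm`, `Drs_isSymm` — and `Carg_coercive_sum`),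
  and as invertibility of `Carg` + `0 ≤ C^{(j)} ≤ γ₀^{−1}` (`Carg_isUnit`, `Carg_mul_Crs`, `Crs_form_bounds`).
  MECHANISM of the lower bound (this file's; [analysis], not a quotation): block Poincaré on the FINE torus with the
  COMPOSITE L^{j+1}-blocks (Q_{j+1} = QQ_j, `B1RG242Torus.Qk_succ`), multiplied by L^{−jd}, turns into
  `min{8,a}‖Q_jφ₀‖² ≤ L²·L^{−jd}⟨φ₀, (−Δ + m²)φ₀⟩ + a⟨Q_jφ₀, Q^*Q Q_jφ₀⟩` by Jensen and the composite-averaging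
  identity `wj_form_EA_succ`; then `Q^*Q ≤ 2·(on ψ) + 2·(on Q_jφ₀ − ψ)` and the variational identity.  No estimate on
  derivatives of block averages and no orthogonal decomposition is needed.

## DISTINCTNESS (other formalizations in the tree)

`Beta/FluctuationCovariance` (pv23-g4) proves (1.15)/(1.16) for the massless site-averaged toy operator
`Cop = Keff + (a₂/L²)·blockP` on `Beta.EffectiveKernel.Tor` via `Keff ≥ c_K(−Δ₁^T)` (an5-g4) and `coercive_torus`
(pv23-g3).  The present file treats a different object — the B1RG242Torus tower's `Drs`/`Crs` on `Site P j`, with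
mass m² ≥ 0, the object read by `B5Display136Torus.K2_eq` and by the leaf `B5Ineq137.Leaf235to237` — by a different
argument (composite-block Poincaré + the variational identity); neither file imports the other.

## NOT-CERTIFIED

(i) Only the whole torus: no regions Ω, Λ, no Neumann/Dirichlet boundary conditions, no *"big blocks"* M — the
constants depend on d through nothing, on L, a and a_j only (printed: *"dependent on d and M only"*, for a fixed L
and a); (ii) U = 1 (no background field A); (iii) the constant `8` in place of `π²` (inherited from `B4Block227`);
(iv) the printed proof of (1.15) (B1 Prop. 2.3, via (2.26)–(2.27) of [4] and the orthogonal decomposition) is NOT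
transcribed — the lower bound is obtained by the composite-block mechanism above, the upper bound from G_j ≥ 0;
(v) (1.16) (the kernel decay of C^{(j)}) is NOT proved here: by the Theorem of Sect. 5 (`B4Sect5Torus.inv_decay`) it
needs, besides `Carg_coercive_sum`, the exponential decay of the entries of Δ^{(j)} = a_j − a_j²Q_jG_jQ^*_j, i.e. of
the block sums of G_j uniformly in j (b04's torus engines `B4TorusKernel`), which is the next node; (vi) levels
j ≥ 1 only (a_0 is not Bałaban's; the j = 0 covariance is `B5Leaf237C0Torus`).

Versions: v1 (p181941, 82302c36239f); v1.1 (this file) — DOCFIX, docstrings only, answering XREAD C-ref6-87 (ref6-g16)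
advisories: A1 (1.15) reads «aL^{−2}P(A)» (A = the background gauge field; v1 had «P(Λ)»; render p004-x2 re-read as
image), A2 the (2.27) quote restored to the printed quadratic-form sentence with the operator paraphrase outside the
quotes, A3 `Marg_coercive`'s tag made an explicit «cf.» locator. No declaration changed.
-/

namespace Literature.MathematicalPhysics.QuantumFieldTheory.Balaban1983to89

namespace B4Ineq115Torus

open Matrix B1RG242Torus B5Display136Torus B5Leaf237C0Torus

/-! ## §1  Block averaging: adjointness, the quadratic form of `Q^*Q`, Jensen -/

section Avg

variable (P : Params) {i i' e : ℕ}

/-- `0 ≤ ‖v‖²`. [folklore] -/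
theorem dot_self_nonneg {ι : Type*} [Fintype ι] (v : ι → ℝ) : 0 ≤ v ⬝ᵥ v :=
  Finset.sum_nonneg fun x _ => mul_self_nonneg (v x)

/-- `‖u + v‖² ≤ 2‖u‖² + 2‖v‖²`. [folklore] -/
theorem add_dot_self_le {ι : Type*} [Fintype ι] (u v : ι → ℝ) :
    (u + v) ⬝ᵥ (u + v) ≤ 2 * (u ⬝ᵥ u) + 2 * (v ⬝ᵥ v) := by
  have h := dot_self_nonneg (u - v)
  rw [sub_dotProduct, dotProduct_sub, dotProduct_sub, dotProduct_comm v u] at h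
  rw [add_dotProduct, dotProduct_add, dotProduct_add, dotProduct_comm v u]
  linarith

/-- `‖v‖² = 0 ⇒ v = 0` over `ℝ`. [folklore] -/
theorem eq_zero_of_dot_self_nonpos {ι : Type*} [Fintype ι] (v : ι → ℝ) (h : v ⬝ᵥ v ≤ 0) : v = 0 := by
  have h0 : v ⬝ᵥ v = 0 := le_antisymm h (dot_self_nonneg v)
  funext x
  have hx := (Finset.sum_eq_zero_iff_of_nonneg fun y _ => mul_self_nonneg (v y)).mp h0 x (Finset.mem_univ x)
  exact mul_self_eq_zero.mp hx

/-- **Adjointness** of the weighted block average and the block extension for the plain (weight-1) scalar products: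
`⟨Q_wφ, θ⟩ = w·⟨φ, Q^*θ⟩` ((1.5)-adjointness with the weights divided out). [cite: Balaban1982Higgs1, (1.5) p.604] -/
theorem avg_dot_eq (w : ℝ) (φ : Site P i → ℝ) (θ : Site P i' → ℝ) :
    (avgMat P i i' e w *ᵥ φ) ⬝ᵥ θ = w * (φ ⬝ᵥ (extMat P i i' e *ᵥ θ)) := by
  rw [avgMat_mulVec_dotProduct, dotProduct_extMat_mulVec]

/-- The quadratic form of `P = Q^*Q_w`: `⟨φ, Q^*Q_wφ⟩ = w^{−1}‖Q_wφ‖²`. [folklore] -/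
theorem form_EA {w : ℝ} (hw : w ≠ 0) (φ : Site P i → ℝ) :
    φ ⬝ᵥ ((extMat P i i' e * avgMat P i i' e w) *ᵥ φ)
      = w⁻¹ * ((avgMat P i i' e w *ᵥ φ) ⬝ᵥ (avgMat P i i' e w *ᵥ φ)) := by
  rw [← Matrix.mulVec_mulVec, avg_dot_eq, ← mul_assoc, inv_mul_cancel₀ hw, one_mul]

/-- `(Q_wφ)(y) = w·Σ_{x ∈ B(y)} φ(x)` as a sum over the fibre. [cite: Balaban1982Higgs1, (2.11) p.609] -/
theorem avgMat_mulVec_eq (w : ℝ) (φ : Site P i → ℝ) (y : Site P i') :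
    (avgMat P i i' e w *ᵥ φ) y = w * ∑ x ∈ Finset.univ.filter (fun x => Site.proj i' e x = y), φ x := by
  rw [avgMat_mulVec, Finset.sum_filter, Finset.mul_sum]
  refine Finset.sum_congr rfl fun x _ => ?_
  split_ifs <;> simp

/-- **Jensen for block averages**: `‖Q_wφ‖² ≤ w·‖φ‖²` for the averaging weight `w = L^{−ed} = |block|^{−1}`
(Cauchy–Schwarz on each block, then the blocks partition the fine torus). [folklore] -/
theorem avg_sq_le (h : P.sitesPerDir i = P.L ^ e * P.sitesPerDir i') (φ : Site P i → ℝ) :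
    (avgMat P i i' e ((((P.L : ℝ) ^ P.d)⁻¹) ^ e) *ᵥ φ) ⬝ᵥ (avgMat P i i' e ((((P.L : ℝ) ^ P.d)⁻¹) ^ e) *ᵥ φ)
      ≤ (((P.L : ℝ) ^ P.d)⁻¹) ^ e * (φ ⬝ᵥ φ) := by
  set W : ℝ := (((P.L : ℝ) ^ P.d)⁻¹) ^ e with hW
  have hW1 : W * (((P.L : ℝ) ^ e) ^ P.d) = 1 := winv_pow_mul_eq_one P e
  have step : ∀ y : Site P i',
      (avgMat P i i' e W *ᵥ φ) y ^ 2
        ≤ W * ∑ x ∈ Finset.univ.filter (fun x => Site.proj i' e x = y), φ x ^ 2 := by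
    intro y
    rw [avgMat_mulVec_eq, mul_pow]
    have cs := sq_sum_le_card_mul_sum_sq
      (s := Finset.univ.filter (fun x : Site P i => Site.proj i' e x = y)) (f := φ)
    rw [Site.card_fibre h y] at cs
    push_cast at cs
    calc W ^ 2 * (∑ x ∈ Finset.univ.filter (fun x => Site.proj i' e x = y), φ x) ^ 2
        ≤ W ^ 2 * ((((P.L : ℝ) ^ e) ^ P.d)
            * ∑ x ∈ Finset.univ.filter (fun x => Site.proj i' e x = y), φ x ^ 2) :=
          mul_le_mul_of_nonneg_left cs (sq_nonneg W)
      _ = W * (W * (((P.L : ℝ) ^ e) ^ P.d))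
            * ∑ x ∈ Finset.univ.filter (fun x => Site.proj i' e x = y), φ x ^ 2 := by ring
      _ = W * ∑ x ∈ Finset.univ.filter (fun x => Site.proj i' e x = y), φ x ^ 2 := by
          rw [hW1, mul_one]
  calc (avgMat P i i' e W *ᵥ φ) ⬝ᵥ (avgMat P i i' e W *ᵥ φ)
      = ∑ y, (avgMat P i i' e W *ᵥ φ) y ^ 2 := by simp only [dotProduct, sq]
    _ ≤ ∑ y, W * ∑ x ∈ Finset.univ.filter (fun x => Site.proj i' e x = y), φ x ^ 2 :=
        Finset.sum_le_sum fun y _ => step y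
    _ = W * (φ ⬝ᵥ φ) := by
        rw [← Finset.mul_sum, Finset.sum_fiberwise Finset.univ (Site.proj i' e) (fun x => φ x ^ 2)]
        simp only [dotProduct, sq]

/-- `0 ≤ ⟨φ, Q^*Q_wφ⟩ ≤ ‖φ‖²` for `w = L^{−ed}` (the block "projection" is a positive contraction for the plain
scalar product). [folklore] -/
theorem form_EA_nonneg_le (h : P.sitesPerDir i = P.L ^ e * P.sitesPerDir i') (φ : Site P i → ℝ) :
    0 ≤ φ ⬝ᵥ ((extMat P i i' e * avgMat P i i' e ((((P.L : ℝ) ^ P.d)⁻¹) ^ e)) *ᵥ φ)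
      ∧ φ ⬝ᵥ ((extMat P i i' e * avgMat P i i' e ((((P.L : ℝ) ^ P.d)⁻¹) ^ e)) *ᵥ φ) ≤ φ ⬝ᵥ φ := by
  have hW0 : 0 < (((P.L : ℝ) ^ P.d)⁻¹) ^ e := pow_pos (inv_pos.mpr (pow_pos P.cast_L_pos _)) _
  rw [form_EA P hW0.ne']
  refine ⟨mul_nonneg (inv_nonneg.mpr hW0.le) (dot_self_nonneg _), ?_⟩
  calc ((((P.L : ℝ) ^ P.d)⁻¹) ^ e)⁻¹ * _ ≤ ((((P.L : ℝ) ^ P.d)⁻¹) ^ e)⁻¹ * ((((P.L : ℝ) ^ P.d)⁻¹) ^ e * (φ ⬝ᵥ φ)) :=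
        mul_le_mul_of_nonneg_left (avg_sq_le P h φ) (inv_nonneg.mpr hW0.le)
    _ = φ ⬝ᵥ φ := by rw [← mul_assoc, inv_mul_cancel₀ hW0.ne', one_mul]

/-- `⟨u + v, Q^*Q(u + v)⟩ ≤ 2⟨u, Q^*Qu⟩ + 2⟨v, Q^*Qv⟩` (convexity of the positive form). [folklore] -/
theorem form_EA_add_le {w : ℝ} (hw : 0 < w) (u v : Site P i → ℝ) :
    (u + v) ⬝ᵥ ((extMat P i i' e * avgMat P i i' e w) *ᵥ (u + v))
      ≤ 2 * (u ⬝ᵥ ((extMat P i i' e * avgMat P i i' e w) *ᵥ u))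
        + 2 * (v ⬝ᵥ ((extMat P i i' e * avgMat P i i' e w) *ᵥ v)) := by
  rw [form_EA P hw.ne', form_EA P hw.ne', form_EA P hw.ne', Matrix.mulVec_add]
  have := add_dot_self_le (avgMat P i i' e w *ᵥ u) (avgMat P i i' e w *ᵥ v)
  have hw' : 0 ≤ w⁻¹ := inv_nonneg.mpr hw.le
  nlinarith [mul_le_mul_of_nonneg_left this hw']

/-- `−Δ^s + m²` is symmetric. [cite: Balaban1982Higgs1, (1.11) p.605] -/
theorem hOp_isSymm (i : ℕ) (s m' : ℝ) : (hOp P i s m').IsSymm := by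
  unfold Matrix.IsSymm hOp
  rw [Matrix.transpose_add, Matrix.transpose_smul, Matrix.transpose_one, Matrix.transpose_sum]
  congr 1
  refine Finset.sum_congr rfl fun μ _ => ?_
  rw [Matrix.transpose_mul, Matrix.transpose_transpose]

/-- `Q^*Q_w` is symmetric. [folklore] -/
theorem EA_isSymm (w : ℝ) : (extMat P i i' e * avgMat P i i' e w).IsSymm := by
  refine Matrix.IsSymm.ext fun x x' => ?_
  rw [EA_apply, EA_apply]
  by_cases hq : Site.proj i' e x' = Site.proj i' e x
  · rw [if_pos hq, if_pos hq.symm]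
  · rw [if_neg hq, if_neg (fun h' => hq h'.symm)]

/-- `Q_w = w·(Q^*)ᵀ`: the weighted average is `w` times the transpose of the extension.
[cite: Balaban1982Higgs1, (1.5) p.604] -/
theorem avgMat_eq_smul_transpose (w : ℝ) : avgMat P i i' e w = w • (extMat P i i' e)ᵀ := by
  ext y x
  simp only [avgMat, extMat, Matrix.transpose_apply, Matrix.smul_apply, smul_eq_mul, mul_ite, mul_one, mul_zero]

end Avg

/-! ## §2  The argument of `G_j^{resc}` (2.22): coercivity, invertibility, positivity -/

section Marg

variable (P : Params)

/-- The averaging weight of `Q_j`: `w_j = L^{−d·lvl j}` (= `L^{−jd}` at Bałaban's levels). [cite: Balaban1982Higgs1, (2.11) p.609] -/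
noncomputable def wj (j : ℕ) : ℝ := (((P.L : ℝ) ^ P.d)⁻¹) ^ lvl P j

/-- The ARGUMENT of the rescaled propagator (2.22): `−Δ^{L^{−j}} + m²(L^jε)² + a_jQ^*_jQ_j` on the fine torus.
[cite: Balaban1982Higgs1, (2.22) p.610] -/
noncomputable def Marg (a msq : ℝ) (j : ℕ) : Matrix (Site P 0) (Site P 0) ℝ :=
  hOp P 0 (P.eps / P.spacing j) (P.spacing j ^ 2 * msq) + B1.aSeq a P.L j • (Qks P j * Qk P j)

/-- `Grs = Marg⁻¹` (definitional). [cite: Balaban1982Higgs1, (2.22) p.610] -/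
theorem Grs_eq (a msq : ℝ) (j : ℕ) : Grs P a msq j = (Marg P a msq j)⁻¹ := rfl

/-- `Q_j` is the `w_j`-weighted `lvl j`-fold block average (definitional). [cite: Balaban1982Higgs1, (2.11) p.609] -/
theorem Qk_eq (j : ℕ) : Qk P j = avgMat P 0 j (lvl P j) (wj P j) := rfl

/-- `Q^*_jQ_j` as extension ∘ average (definitional). [cite: Balaban1982Higgs1, (2.20) p.610] -/
theorem QksQk_eq (j : ℕ) : Qks P j * Qk P j = extMat P 0 j (lvl P j) * avgMat P 0 j (lvl P j) (wj P j) := rfl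

/-- `Q^*_jQ_j` with the weight written out (definitional; the shape produced by `block_poincare`).
[cite: Balaban1982Higgs1, (2.20) p.610] -/
theorem QksQk_eq' (j : ℕ) :
    Qks P j * Qk P j = extMat P 0 j (lvl P j) * avgMat P 0 j (lvl P j) ((((P.L : ℝ) ^ P.d)⁻¹) ^ lvl P j) := rfl

/-- `0 < w_j`. [folklore] -/
theorem wj_pos (j : ℕ) : 0 < wj P j := pow_pos (inv_pos.mpr (pow_pos P.cast_L_pos _)) _

/-- `w_{j+1} = w_j · L^{−d·stepExp j}` (`lvl (j+1) = lvl j + stepExp j`). [folklore] -/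
theorem wj_succ (j : ℕ) : wj P (j + 1) = wj P j * (((P.L : ℝ) ^ P.d)⁻¹) ^ stepExp P j := by
  rw [wj, wj, lvl_succ, pow_add]

/-- The derivative of spacing `ε/(L^jε) = L^{−j}` is `L^j` times the unit-lattice derivative. [folklore] -/
theorem deriv_eps_div_spacing (j : ℕ) (μ : Fin P.d) :
    deriv P 0 (P.eps / P.spacing j) μ = ((P.L : ℝ) ^ j) • deriv P 0 1 μ := by
  have hε : P.eps ≠ 0 := P.eps_pos.ne'
  rw [B1RG242Torus.deriv, B1RG242Torus.deriv, inv_one, one_smul, inv_div, Params.spacing,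
    mul_div_assoc, div_self hε, mul_one]

variable {P}

/-- The form of the rescaled mass–Laplacian: `⟨φ, (−Δ^{L^{−j}} + (L^jε)²m²)φ⟩ = (L^jε)²m²‖φ‖² + L^{2j}Σ_μ‖∂¹_μφ‖²`.
[cite: Balaban1982Higgs1, (1.11) p.605] -/
theorem form_hOp_spacing (msq : ℝ) (j : ℕ) (φ : Site P 0 → ℝ) :
    φ ⬝ᵥ (hOp P 0 (P.eps / P.spacing j) (P.spacing j ^ 2 * msq) *ᵥ φ)
      = P.spacing j ^ 2 * msq * (φ ⬝ᵥ φ)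
        + ((P.L : ℝ) ^ j) ^ 2 * ∑ μ, (deriv P 0 1 μ *ᵥ φ) ⬝ᵥ (deriv P 0 1 μ *ᵥ φ) := by
  rw [form_hOp, Finset.mul_sum]
  congr 1
  refine Finset.sum_congr rfl fun μ _ => ?_
  rw [deriv_eps_div_spacing, Matrix.smul_mulVec, smul_dotProduct, dotProduct_smul, smul_eq_mul, smul_eq_mul]
  ring

/-- The quadratic form of `Marg`: `⟨φ, Marg φ⟩ = (L^jε)²m²‖φ‖² + L^{2j}Σ_μ‖∂¹_μφ‖² + a_j⟨φ, Q^*_jQ_jφ⟩`.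
[cite: Balaban1982Higgs1, (2.22) p.610] -/
theorem form_Marg (a msq : ℝ) (j : ℕ) (φ : Site P 0 → ℝ) :
    φ ⬝ᵥ (Marg P a msq j *ᵥ φ)
      = P.spacing j ^ 2 * msq * (φ ⬝ᵥ φ)
        + ((P.L : ℝ) ^ j) ^ 2 * ∑ μ, (deriv P 0 1 μ *ᵥ φ) ⬝ᵥ (deriv P 0 1 μ *ᵥ φ)
        + B1.aSeq a P.L j * (φ ⬝ᵥ ((Qks P j * Qk P j) *ᵥ φ)) := by
  rw [Marg, Matrix.add_mulVec, dotProduct_add, Matrix.smul_mulVec, dotProduct_smul, smul_eq_mul,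
    form_hOp_spacing]

/-- **Coercivity of the argument of G_j^{resc}**: `min{8, a_j}‖φ‖² ≤ ⟨φ, Marg φ⟩` for every real `φ` on the fine
torus, m² ≥ 0, j ≥ 1 — block Poincaré with the L^{lvl j}-blocks of `Q_j` (cf. (2.27) of [4], here on the torus and
with the constant `8` in place of `π²`; the tag is a locator, not a citation of the constant).
[cite: Balaban1983RegularityDecay, cf. (2.27) p.580] [folklore] -/
theorem Marg_coercive {a msq : ℝ} (hm : 0 ≤ msq) (j : ℕ) (φ : Site P 0 → ℝ) :
    min 8 (B1.aSeq a P.L j) * (φ ⬝ᵥ φ) ≤ φ ⬝ᵥ (Marg P a msq j *ᵥ φ) := by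
  have bp := block_poincare P (sitesPerDir_zero_eq P j) (B1.aSeq a P.L j) φ
  rw [form_Marg]
  have hD : 0 ≤ ∑ μ, (deriv P 0 1 μ *ᵥ φ) ⬝ᵥ (deriv P 0 1 μ *ᵥ φ) :=
    Finset.sum_nonneg fun μ _ => dot_self_nonneg _
  have hpow : ((P.L : ℝ) ^ lvl P j) ^ 2 ≤ ((P.L : ℝ) ^ j) ^ 2 :=
    pow_le_pow_left₀ (by positivity) (pow_le_pow_right₀ (one_lt_cast_L P).le (min_le_left _ _)) 2
  have hmass : 0 ≤ P.spacing j ^ 2 * msq * (φ ⬝ᵥ φ) := mul_nonneg (by positivity) (dot_self_nonneg _)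
  have := mul_le_mul_of_nonneg_right hpow hD
  rw [← QksQk_eq'] at bp
  linarith

/-- `Marg` has trivial kernel (m² ≥ 0, j ≥ 1). [folklore] -/
theorem Marg_ker {a msq : ℝ} (ha : 0 < a) (hm : 0 ≤ msq) {j : ℕ} (hj : 1 ≤ j) (φ : Site P 0 → ℝ)
    (h0 : Marg P a msq j *ᵥ φ = 0) : φ = 0 := by
  have hA : 0 < B1.aSeq a P.L j := B1.aSeq_pos ha (one_lt_cast_L P) hj
  have hmin : 0 < min 8 (B1.aSeq a P.L j) := lt_min (by norm_num) hA
  have hc := Marg_coercive (P := P) (a := a) hm j φ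
  rw [h0, dotProduct_zero] at hc
  exact eq_zero_of_dot_self_nonpos φ (by nlinarith [dot_self_nonneg φ])

/-- **`Marg` is invertible** — an independent (coercivity) proof that G_j^{resc} of (2.22) is a genuine inverse on
the torus (cf. `B1RG242Torus.G_arg` via the kernel lemma). [cite: Balaban1982Higgs1, (2.22) p.610] -/
theorem Marg_isUnit {a msq : ℝ} (ha : 0 < a) (hm : 0 ≤ msq) {j : ℕ} (hj : 1 ≤ j) :
    IsUnit (Marg P a msq j) := by
  rw [← Matrix.mulVec_injective_iff_isUnit]
  exact B1RG242.mulVec_injective_of_ker fun φ h0 => Marg_ker ha hm hj φ h0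

/-- `det Marg` is a unit. [folklore] -/
theorem Marg_det_isUnit {a msq : ℝ} (ha : 0 < a) (hm : 0 ≤ msq) {j : ℕ} (hj : 1 ≤ j) :
    IsUnit (Marg P a msq j).det :=
  (Matrix.isUnit_iff_isUnit_det _).mp (Marg_isUnit ha hm hj)

/-- `Marg · Grs = 1`. [folklore] -/
theorem Marg_mul_Grs {a msq : ℝ} (ha : 0 < a) (hm : 0 ≤ msq) {j : ℕ} (hj : 1 ≤ j) :
    Marg P a msq j * Grs P a msq j = 1 := by
  rw [Grs_eq, Matrix.mul_nonsing_inv _ (Marg_det_isUnit ha hm hj)]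

/-- `Grs · Marg = 1`. [folklore] -/
theorem Grs_mul_Marg {a msq : ℝ} (ha : 0 < a) (hm : 0 ≤ msq) {j : ℕ} (hj : 1 ≤ j) :
    Grs P a msq j * Marg P a msq j = 1 := by
  rw [Grs_eq, Matrix.nonsing_inv_mul _ (Marg_det_isUnit ha hm hj)]

/-- **G_j^{resc} ≥ 0**: `0 ≤ ⟨u, Grs u⟩` (indeed `≥ min{8,a_j}·‖Grs u‖²`). [cite: Balaban1982Higgs1, (2.22) p.610] -/
theorem Grs_form_nonneg {a msq : ℝ} (ha : 0 < a) (hm : 0 ≤ msq) {j : ℕ} (hj : 1 ≤ j) (u : Site P 0 → ℝ) :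
    0 ≤ u ⬝ᵥ (Grs P a msq j *ᵥ u) := by
  set v := Grs P a msq j *ᵥ u with hv
  have hu : Marg P a msq j *ᵥ v = u := by
    rw [hv, Matrix.mulVec_mulVec, Marg_mul_Grs ha hm hj, Matrix.one_mulVec]
  have hA : 0 < B1.aSeq a P.L j := B1.aSeq_pos ha (one_lt_cast_L P) hj
  have hmin : 0 < min 8 (B1.aSeq a P.L j) := lt_min (by norm_num) hA
  have hc := Marg_coercive (P := P) (a := a) hm j v
  rw [hu] at hc
  calc (0 : ℝ) ≤ min 8 (B1.aSeq a P.L j) * (v ⬝ᵥ v) := mul_nonneg hmin.le (dot_self_nonneg v)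
    _ ≤ v ⬝ᵥ u := hc
    _ = u ⬝ᵥ v := dotProduct_comm v u

/-- `Marg` is symmetric. [folklore] -/
theorem Marg_isSymm (a msq : ℝ) (j : ℕ) : (Marg P a msq j).IsSymm := by
  rw [Marg, QksQk_eq]
  exact (hOp_isSymm P 0 _ _).add ((EA_isSymm P _).smul _)

/-- `Grs` is symmetric. [folklore] -/
theorem Grs_isSymm (a msq : ℝ) (j : ℕ) : (Grs P a msq j).IsSymm := by
  unfold Matrix.IsSymm
  rw [Grs_eq, Matrix.transpose_nonsing_inv, (Marg_isSymm (P := P) a msq j).eq]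

end Marg

/-! ## §3  The variational identity behind (2.19)–(2.21) -/

section Variational

variable (P : Params)

/-- The minimiser of the quadratic exponent of (2.19): `φ₀ = a_j·G_j^{resc}Q^*_jψ`. [cite: Balaban1982Higgs1, (2.19) p.610] -/
noncomputable def phi0 (a msq : ℝ) (j : ℕ) (ψ : Site P j → ℝ) : Site P 0 → ℝ :=
  B1.aSeq a P.L j • (Grs P a msq j *ᵥ (Qks P j *ᵥ ψ))

variable {P}

/-- The Euler–Lagrange equation: `Marg φ₀ = a_jQ^*_jψ`. [folklore] -/
theorem Marg_phi0 {a msq : ℝ} (ha : 0 < a) (hm : 0 ≤ msq) {j : ℕ} (hj : 1 ≤ j) (ψ : Site P j → ℝ) :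
    Marg P a msq j *ᵥ phi0 P a msq j ψ = B1.aSeq a P.L j • (Qks P j *ᵥ ψ) := by
  rw [phi0, Matrix.mulVec_smul, Matrix.mulVec_mulVec, Marg_mul_Grs ha hm hj, Matrix.one_mulVec]

/-- (2.21) unfolded on a vector: `Δ^{(j)}ψ = a_jψ − a_j·Q_jφ₀`. [cite: Balaban1982Higgs1, (2.21) p.610] -/
theorem Drs_mulVec (a msq : ℝ) (j : ℕ) (ψ : Site P j → ℝ) :
    Drs P a msq j *ᵥ ψ = B1.aSeq a P.L j • ψ - B1.aSeq a P.L j • (Qk P j *ᵥ phi0 P a msq j ψ) := by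
  rw [Drs, Matrix.sub_mulVec, Matrix.smul_mulVec, Matrix.one_mulVec, Matrix.smul_mulVec, phi0,
    Matrix.mulVec_smul, smul_smul, ← sq, Matrix.mul_assoc, ← Matrix.mulVec_mulVec, ← Matrix.mulVec_mulVec]

/-- **THE VARIATIONAL IDENTITY** ((2.19) ⇒ (2.21) at the minimiser, rescaled to the unit lattice):
`⟨ψ, Δ^{(j)}ψ⟩ = w_j·⟨φ₀, (−Δ^{L^{−j}} + (L^jε)²m²)φ₀⟩ + a_j·‖Q_jφ₀ − ψ‖²`, `φ₀ = a_jG_j^{resc}Q^*_jψ`, `w_j = L^{−jd}`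
(pure algebra from `Marg·Grs = 1` and the adjointness `⟨Q_jφ, θ⟩ = w_j⟨φ, Q^*_jθ⟩`).
[cite: Balaban1982Higgs1, (2.19)–(2.21) p.610] -/
theorem form_Drs {a msq : ℝ} (ha : 0 < a) (hm : 0 ≤ msq) {j : ℕ} (hj : 1 ≤ j) (ψ : Site P j → ℝ) :
    ψ ⬝ᵥ (Drs P a msq j *ᵥ ψ)
      = wj P j * (phi0 P a msq j ψ ⬝ᵥ (hOp P 0 (P.eps / P.spacing j) (P.spacing j ^ 2 * msq) *ᵥ phi0 P a msq j ψ))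
        + B1.aSeq a P.L j
          * ((Qk P j *ᵥ phi0 P a msq j ψ - ψ) ⬝ᵥ (Qk P j *ᵥ phi0 P a msq j ψ - ψ)) := by
  set A : ℝ := B1.aSeq a P.L j with hAdef
  set φ₀ := phi0 P a msq j ψ with hφ₀
  set g := Qk P j *ᵥ φ₀ with hg
  set w := wj P j with hwdef
  have hw : w ≠ 0 := (wj_pos P j).ne'
  -- ⟨φ₀, Marg φ₀⟩ two ways
  have e1 : φ₀ ⬝ᵥ (Marg P a msq j *ᵥ φ₀)
      = φ₀ ⬝ᵥ (hOp P 0 (P.eps / P.spacing j) (P.spacing j ^ 2 * msq) *ᵥ φ₀) + A * (w⁻¹ * (g ⬝ᵥ g)) := by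
    rw [Marg, Matrix.add_mulVec, dotProduct_add, Matrix.smul_mulVec, dotProduct_smul, smul_eq_mul, QksQk_eq,
      form_EA P hw]
    rfl
  have e2 : φ₀ ⬝ᵥ (Marg P a msq j *ᵥ φ₀) = A * (w⁻¹ * (g ⬝ᵥ ψ)) := by
    rw [hφ₀, Marg_phi0 ha hm hj, ← hφ₀, dotProduct_smul, smul_eq_mul]
    congr 1
    have had := avg_dot_eq P (i := 0) (i' := j) (e := lvl P j) w φ₀ ψ
    rw [← Qk_eq] at had
    change g ⬝ᵥ ψ = w * (φ₀ ⬝ᵥ (Qks P j *ᵥ ψ)) at had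
    rw [had, ← mul_assoc, inv_mul_cancel₀ hw, one_mul]
  have key : w * (φ₀ ⬝ᵥ (hOp P 0 (P.eps / P.spacing j) (P.spacing j ^ 2 * msq) *ᵥ φ₀))
      = A * (g ⬝ᵥ ψ) - A * (g ⬝ᵥ g) := by
    have hH : φ₀ ⬝ᵥ (hOp P 0 (P.eps / P.spacing j) (P.spacing j ^ 2 * msq) *ᵥ φ₀)
        = A * (w⁻¹ * (g ⬝ᵥ ψ)) - A * (w⁻¹ * (g ⬝ᵥ g)) := by linarith [e1.symm.trans e2]
    have hww : w * w⁻¹ = 1 := mul_inv_cancel₀ hw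
    rw [hH]
    calc w * (A * (w⁻¹ * (g ⬝ᵥ ψ)) - A * (w⁻¹ * (g ⬝ᵥ g)))
        = (w * w⁻¹) * (A * (g ⬝ᵥ ψ)) - (w * w⁻¹) * (A * (g ⬝ᵥ g)) := by ring
      _ = A * (g ⬝ᵥ ψ) - A * (g ⬝ᵥ g) := by rw [hww, one_mul, one_mul]
  have lhs : ψ ⬝ᵥ (Drs P a msq j *ᵥ ψ) = A * (ψ ⬝ᵥ ψ) - A * (g ⬝ᵥ ψ) := by
    rw [Drs_mulVec, ← hφ₀, ← hg, dotProduct_sub, dotProduct_smul, dotProduct_smul, smul_eq_mul, smul_eq_mul,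
      dotProduct_comm ψ g]
  rw [lhs, key, sub_dotProduct, dotProduct_sub, dotProduct_sub, dotProduct_comm ψ g]
  ring

/-- **Δ^{(j)} ≥ 0** on the torus. [cite: Balaban1982Higgs1, (2.21) p.610] -/
theorem form_Drs_nonneg {a msq : ℝ} (ha : 0 < a) (hm : 0 ≤ msq) {j : ℕ} (hj : 1 ≤ j) (ψ : Site P j → ℝ) :
    0 ≤ ψ ⬝ᵥ (Drs P a msq j *ᵥ ψ) := by
  rw [form_Drs ha hm hj]
  have hA : 0 < B1.aSeq a P.L j := B1.aSeq_pos ha (one_lt_cast_L P) hj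
  exact add_nonneg (mul_nonneg (wj_pos P j).le (form_hOp_nonneg _ (by positivity) _))
    (mul_nonneg hA.le (dot_self_nonneg _))

/-- **Δ^{(j)} ≤ a_j ≤ a** on the torus (from G_j^{resc} ≥ 0 in (2.21)). [cite: Balaban1982Higgs1, (2.21) p.610] -/
theorem form_Drs_le {a msq : ℝ} (ha : 0 < a) (hm : 0 ≤ msq) {j : ℕ} (hj : 1 ≤ j) (ψ : Site P j → ℝ) :
    ψ ⬝ᵥ (Drs P a msq j *ᵥ ψ) ≤ B1.aSeq a P.L j * (ψ ⬝ᵥ ψ) := by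
  have hA : 0 < B1.aSeq a P.L j := B1.aSeq_pos ha (one_lt_cast_L P) hj
  have hw := wj_pos P j
  -- ψ ⬝ (Q_j G Q^*_j ψ) = w_j ⟨Q^*_jψ, G Q^*_jψ⟩ ≥ 0
  have hpos : 0 ≤ ψ ⬝ᵥ ((Qk P j * Grs P a msq j * Qks P j) *ᵥ ψ) := by
    rw [← Matrix.mulVec_mulVec, ← Matrix.mulVec_mulVec, dotProduct_comm, Qk_eq, avg_dot_eq]
    exact mul_nonneg hw.le (by
      rw [dotProduct_comm]
      exact Grs_form_nonneg ha hm hj (Qks P j *ᵥ ψ))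
  rw [Drs, Matrix.sub_mulVec, dotProduct_sub, Matrix.smul_mulVec, Matrix.one_mulVec, dotProduct_smul, smul_eq_mul,
    Matrix.smul_mulVec, dotProduct_smul, smul_eq_mul]
  nlinarith [sq_nonneg (B1.aSeq a P.L j)]

/-- `Δ^{(j)}` is symmetric (Q_j = w_j·(Q^*_j)ᵀ and G_j^{resc} symmetric). [cite: Balaban1982Higgs1, (2.21) p.610] -/
theorem Drs_isSymm (a msq : ℝ) (j : ℕ) : (Drs P a msq j).IsSymm := by
  have hw : wj P j ≠ 0 := (wj_pos P j).ne'
  have hQk : Qk P j = wj P j • (Qks P j)ᵀ := by rw [Qk_eq, avgMat_eq_smul_transpose]; rfl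
  have hT : (Qk P j * Grs P a msq j * Qks P j).IsSymm := by
    unfold Matrix.IsSymm
    rw [Matrix.transpose_mul, Matrix.transpose_mul, (Grs_isSymm (P := P) a msq j).eq, hQk, Matrix.transpose_smul,
      Matrix.transpose_transpose, Matrix.smul_mul, Matrix.smul_mul, Matrix.mul_smul, Matrix.mul_assoc]
    rw [Matrix.mul_smul]
  unfold Matrix.IsSymm
  rw [Drs, Matrix.transpose_sub, Matrix.transpose_smul, Matrix.transpose_smul, Matrix.transpose_one, hT.eq]

end Variational

/-! ## §4  (1.15) on the torus -/

section Ineq115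

variable (P : Params)

/-- The ARGUMENT of the rescaled covariance (2.31): `aL^{−2}Q^*Q + Δ^{(j)}` on `T₁^{(j)}`.
[cite: Balaban1982Higgs1, (2.31) p.611] -/
noncomputable def Carg (a msq : ℝ) (j : ℕ) : Matrix (Site P j) (Site P j) ℝ :=
  (a * ((P.L : ℝ) ^ 2)⁻¹) • (Qs P j * Q P j) + Drs P a msq j

/-- `Crs = Carg⁻¹` (definitional). [cite: Balaban1982Higgs1, (2.31) p.611] -/
theorem Crs_eq (a msq : ℝ) (j : ℕ) : Crs P a msq j = (Carg P a msq j)⁻¹ := rfl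

/-- The one-step `Q^*Q` on `T₁^{(j)}` as extension ∘ average (definitional). [cite: Balaban1982Higgs1, (2.7) p.608] -/
theorem QsQ_eq (j : ℕ) :
    Qs P j * Q P j = extMat P j (j + 1) (stepExp P j) * avgMat P j (j + 1) (stepExp P j)
      ((((P.L : ℝ) ^ P.d)⁻¹) ^ stepExp P j) := rfl

/-- **The explicit (1.15) lower constant** at level j: `γ₀(L, a, a_j) = ((4L² + 4a/a_j)/min{8,a} + 2/a_j)^{−1}`.
NOT Bałaban's γ₀ (his depends on d and M through π² and the big blocks); ours depends on L, a, a_j only.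
[cite: Balaban1983RegularityDecay, (1.15) p.574] -/
noncomputable def gamma115 (L a aj : ℝ) : ℝ := ((4 * L ^ 2 + 4 * a / aj) / min 8 a + 2 / aj)⁻¹

/-- **The level-free (1.15) lower constant**: `gamma115` with `a/a_j` and `1/a_j` replaced by their suprema over
`a(1 − L^{−2}) < a_j` , i.e. `a/a_j ≤ L²/(L² − 1)`, `1/a_j ≤ L²/((L² − 1)a)`. [cite: Balaban1983RegularityDecay, (1.15) p.574] -/
noncomputable def gamma115u (L a : ℝ) : ℝ :=
  ((4 * L ^ 2 + 4 * (L ^ 2 / (L ^ 2 - 1))) / min 8 a + 2 * (L ^ 2 / ((L ^ 2 - 1) * a)))⁻¹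

variable {P}

/-- `0 < gamma115 L a a_j` for `a, a_j > 0`. [folklore] -/
theorem gamma115_pos {L a aj : ℝ} (ha : 0 < a) (haj : 0 < aj) : 0 < gamma115 L a aj := by
  have hmin : 0 < min 8 a := lt_min (by norm_num) ha
  unfold gamma115
  positivity

/-- `0 < gamma115u L a` for `a > 0`, `L > 1`. [folklore] -/
theorem gamma115u_pos {L a : ℝ} (ha : 0 < a) (hL : 1 < L) : 0 < gamma115u L a := by
  have hmin : 0 < min 8 a := lt_min (by norm_num) ha
  have hL2 : 0 < L ^ 2 - 1 := by nlinarith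
  unfold gamma115u
  positivity

/-- Monotonicity: the level-free constant is below the level-j constant whenever `a(1 − L^{−2}) < a_j`.
[cite: Balaban1982Higgs1, (2.15) p.609] -/
theorem gamma115u_le {L a aj : ℝ} (ha : 0 < a) (hL : 1 < L) (haj : a * (1 - (L ^ 2)⁻¹) < aj) :
    gamma115u L a ≤ gamma115 L a aj := by
  have hmin : 0 < min 8 a := lt_min (by norm_num) ha
  have hL2 : 0 < L ^ 2 - 1 := by nlinarith
  have hL0 : 0 < L ^ 2 := by positivity
  have hlow : 0 < a * (1 - (L ^ 2)⁻¹) := by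
    have : 0 < 1 - (L ^ 2)⁻¹ := by
      rw [sub_pos, inv_lt_one_iff₀]; right; nlinarith
    positivity
  have haj0 : 0 < aj := hlow.trans haj
  -- a/aj ≤ L²/(L²−1) and 1/aj ≤ L²/((L²−1)a)
  have e1 : a * (1 - (L ^ 2)⁻¹) = a * (L ^ 2 - 1) / L ^ 2 := by field_simp
  have h1 : a / aj ≤ L ^ 2 / (L ^ 2 - 1) := by
    rw [div_le_div_iff₀ haj0 hL2]
    rw [e1, div_lt_iff₀ hL0] at haj
    nlinarith
  have h2 : 2 / aj ≤ 2 * (L ^ 2 / ((L ^ 2 - 1) * a)) := by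
    rw [← mul_one_div 2 aj]  -- 2/aj = 2 * (1/aj)
    refine mul_le_mul_of_nonneg_left ?_ (by norm_num)
    rw [div_le_div_iff₀ haj0 (mul_pos hL2 ha)]
    rw [e1, div_lt_iff₀ hL0] at haj
    nlinarith
  unfold gamma115u gamma115
  refine inv_anti₀ (by positivity) ?_
  have h3 : (4 * L ^ 2 + 4 * a / aj) / min 8 a ≤ (4 * L ^ 2 + 4 * (L ^ 2 / (L ^ 2 - 1))) / min 8 a := by
    refine div_le_div_of_nonneg_right ?_ hmin.le
    rw [mul_div_assoc]
    linarith
  linarith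

/-- The bookkeeping of the lower bound: from `q ≤ 2p + 2r`, `m·G ≤ L²S + a·q`, `N ≤ 2G + 2r` (all pieces
nonnegative) to `γ₀·N ≤ aL^{−2}p + S + A·r` with `γ₀ = ((4L² + 4a/A)/m + 2/A)^{−1}`. [folklore] -/
theorem arith115 {L2 a A m S p r q G N : ℝ} (hL : 0 < L2) (ha : 0 < a) (hA : 0 < A) (hm : 0 < m)
    (hS : 0 ≤ S) (hp : 0 ≤ p) (hr : 0 ≤ r)
    (hq : q ≤ 2 * p + 2 * r) (hmain : m * G ≤ L2 * S + a * q) (hN : N ≤ 2 * G + 2 * r) :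
    ((4 * L2 + 4 * a / A) / m + 2 / A)⁻¹ * N ≤ a * L2⁻¹ * p + (S + A * r) := by
  set E : ℝ := a * L2⁻¹ * p + (S + A * r) with hE
  have hK : 0 < (4 * L2 + 4 * a / A) / m + 2 / A := by positivity
  rw [inv_mul_le_iff₀ hK]
  have hE0 : 0 ≤ a * L2⁻¹ * p := by positivity
  have h1 : 2 * r ≤ 2 / A * E := by
    have e : 2 / A * (A * r) = 2 * r := by field_simp
    calc 2 * r = 2 / A * (A * r) := e.symm
      _ ≤ 2 / A * E := mul_le_mul_of_nonneg_left (by linarith) (by positivity)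
  have h2 : 4 * a * p + 4 * L2 * S ≤ 4 * L2 * E := by
    have e : 4 * L2 * (a * L2⁻¹ * p) = 4 * a * p := by field_simp
    have : 0 ≤ 4 * L2 * (A * r) := by positivity
    calc 4 * a * p + 4 * L2 * S = 4 * L2 * (a * L2⁻¹ * p) + 4 * L2 * S := by rw [e]
      _ ≤ 4 * L2 * (a * L2⁻¹ * p) + 4 * L2 * S + 4 * L2 * (A * r) := by linarith
      _ = 4 * L2 * E := by rw [hE]; ring
  have h3 : 4 * a * r ≤ 4 * a / A * E := by
    have e : 4 * a / A * (A * r) = 4 * a * r := by field_simp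
    calc 4 * a * r = 4 * a / A * (A * r) := e.symm
      _ ≤ 4 * a / A * E := mul_le_mul_of_nonneg_left (by linarith) (by positivity)
  have h4 : m * G ≤ L2 * S + 2 * a * p + 2 * a * r := by
    have := mul_le_mul_of_nonneg_left hq ha.le
    linarith
  have h5 : 2 * G ≤ (4 * L2 * E + 4 * a / A * E) / m := by
    rw [le_div_iff₀ hm]
    nlinarith
  calc N ≤ 2 * G + 2 * r := hN
    _ ≤ (4 * L2 * E + 4 * a / A * E) / m + 2 / A * E := by linarith
    _ = ((4 * L2 + 4 * a / A) / m + 2 / A) * E := by ring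

/-- `(L^{lvl(j+1)})² ≤ L²·(L^j)²`. [folklore] -/
theorem pow_lvl_succ_sq_le (j : ℕ) : ((P.L : ℝ) ^ lvl P (j + 1)) ^ 2 ≤ (P.L : ℝ) ^ 2 * ((P.L : ℝ) ^ j) ^ 2 := by
  have hL := (one_lt_cast_L P).le
  have h1 : (P.L : ℝ) ^ lvl P (j + 1) ≤ (P.L : ℝ) ^ (j + 1) := pow_le_pow_right₀ hL (min_le_left _ _)
  calc ((P.L : ℝ) ^ lvl P (j + 1)) ^ 2 ≤ ((P.L : ℝ) ^ (j + 1)) ^ 2 := pow_le_pow_left₀ (by positivity) h1 2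
    _ = (P.L : ℝ) ^ 2 * ((P.L : ℝ) ^ j) ^ 2 := by ring

/-- **The composite-averaging identity**: `w_j·⟨φ, Q^*_{j+1}Q_{j+1}φ⟩ = ⟨Q_jφ, Q^*Q·Q_jφ⟩` (B^{j+1}(z) = ⋃_{y∈B(z)}
B^j(y): `Q_{j+1} = QQ_j`). [cite: Balaban1982Higgs1, (2.12) p.609] -/
theorem wj_form_EA_succ (j : ℕ) (φ : Site P 0 → ℝ) :
    wj P j * (φ ⬝ᵥ ((Qks P (j + 1) * Qk P (j + 1)) *ᵥ φ))
      = (Qk P j *ᵥ φ) ⬝ᵥ ((Qs P j * Q P j) *ᵥ (Qk P j *ᵥ φ)) := by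
  have hw := wj_pos P j
  have hw1 := wj_pos P (j + 1)
  have hw' : 0 < (((P.L : ℝ) ^ P.d)⁻¹) ^ stepExp P j := pow_pos (inv_pos.mpr (pow_pos P.cast_L_pos _)) _
  rw [QksQk_eq, form_EA P hw1.ne', ← Qk_eq, QsQ_eq, form_EA P hw'.ne', Matrix.mulVec_mulVec,
    show avgMat P j (j + 1) (stepExp P j) ((((P.L : ℝ) ^ P.d)⁻¹) ^ stepExp P j) * Qk P j = Qk P (j + 1) from
      (Qk_succ P j).symm, wj_succ, mul_inv, ← mul_assoc, ← mul_assoc, mul_inv_cancel₀ hw.ne', one_mul]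

/-- **(1.15), LOWER BOUND, ON THE TORUS**: for every real `ψ` on `T₁^{(j)}`, `j ≥ 1`, `m² ≥ 0`, `a > 0`,
`γ₀(L,a,a_j)·‖ψ‖² ≤ ⟨ψ, (aL^{−2}Q^*Q + Δ^{(j)})ψ⟩`, `γ₀ = gamma115 L a a_j` — uniformly in the volume, the cutoff and
m². [cite: Balaban1983RegularityDecay, (1.15) p.574] -/
theorem ineq115_lower {a msq : ℝ} (ha : 0 < a) (hm : 0 ≤ msq) {j : ℕ} (hj : 1 ≤ j) (ψ : Site P j → ℝ) :
    gamma115 P.L a (B1.aSeq a P.L j) * (ψ ⬝ᵥ ψ) ≤ ψ ⬝ᵥ (Carg P a msq j *ᵥ ψ) := by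
  have hLr := one_lt_cast_L P
  have hA : 0 < B1.aSeq a P.L j := B1.aSeq_pos ha hLr hj
  have hmin : 0 < min 8 a := lt_min (by norm_num) ha
  have hL0 : (0 : ℝ) < (P.L : ℝ) ^ 2 := by positivity
  have hw := wj_pos P j
  have hw' : 0 < (((P.L : ℝ) ^ P.d)⁻¹) ^ stepExp P j := pow_pos (inv_pos.mpr (pow_pos P.cast_L_pos _)) _
  set A : ℝ := B1.aSeq a P.L j with hAdef
  set φ₀ := phi0 P a msq j ψ with hφ₀
  set g := Qk P j *ᵥ φ₀ with hg
  set PP := Qs P j * Q P j with hPP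
  -- the pieces
  set S : ℝ := wj P j * (φ₀ ⬝ᵥ (hOp P 0 (P.eps / P.spacing j) (P.spacing j ^ 2 * msq) *ᵥ φ₀)) with hS
  set r : ℝ := (g - ψ) ⬝ᵥ (g - ψ) with hr
  set p : ℝ := ψ ⬝ᵥ (PP *ᵥ ψ) with hp
  set q : ℝ := g ⬝ᵥ (PP *ᵥ g) with hq
  set G : ℝ := g ⬝ᵥ g with hG
  set N : ℝ := ψ ⬝ᵥ ψ with hN
  set D : ℝ := ∑ μ, (deriv P 0 1 μ *ᵥ φ₀) ⬝ᵥ (deriv P 0 1 μ *ᵥ φ₀) with hDdef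
  -- the total form
  have hE : ψ ⬝ᵥ (Carg P a msq j *ᵥ ψ) = a * ((P.L : ℝ) ^ 2)⁻¹ * p + (S + A * r) := by
    rw [Carg, Matrix.add_mulVec, dotProduct_add, Matrix.smul_mulVec, dotProduct_smul, smul_eq_mul,
      form_Drs ha hm hj]
  -- signs and contraction
  have hS0 : 0 ≤ S := mul_nonneg hw.le (form_hOp_nonneg _ (by positivity) _)
  have hr0 : 0 ≤ r := dot_self_nonneg _
  have hG0 : 0 ≤ G := dot_self_nonneg _
  have hp01 := form_EA_nonneg_le P (sitesPerDir_eq_succ P j) ψ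
  rw [← QsQ_eq] at hp01
  have hp0 : 0 ≤ p := hp01.1
  have hrr := (form_EA_nonneg_le P (sitesPerDir_eq_succ P j) (g - ψ)).2
  rw [← QsQ_eq] at hrr
  have hq2 : q ≤ 2 * p + 2 * r := by
    have h := form_EA_add_le P (i := j) (i' := j + 1) (e := stepExp P j) hw' ψ (g - ψ)
    rw [← QsQ_eq, add_sub_cancel] at h
    linarith
  -- block Poincaré on the fine torus with the composite L^{lvl(j+1)}-blocks, times w_j
  have bp := block_poincare P (sitesPerDir_zero_eq P (j + 1)) a φ₀
  rw [← QksQk_eq'] at bp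
  have comp : wj P j * (φ₀ ⬝ᵥ ((Qks P (j + 1) * Qk P (j + 1)) *ᵥ φ₀)) = q := wj_form_EA_succ j φ₀
  have hD0 : 0 ≤ D := Finset.sum_nonneg fun μ _ => dot_self_nonneg _
  -- S ≥ w_j L^{2j} D
  have hSD : wj P j * (((P.L : ℝ) ^ j) ^ 2 * D) ≤ S := by
    rw [hS, form_hOp_spacing, ← hDdef]
    refine mul_le_mul_of_nonneg_left ?_ hw.le
    have : 0 ≤ P.spacing j ^ 2 * msq * (φ₀ ⬝ᵥ φ₀) := mul_nonneg (by positivity) (dot_self_nonneg _)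
    linarith
  have hlv := pow_lvl_succ_sq_le (P := P) j
  -- Jensen
  have hJ : G ≤ wj P j * (φ₀ ⬝ᵥ φ₀) := avg_sq_le P (sitesPerDir_zero_eq P j) φ₀
  -- min{8,a}·G ≤ L²S + a q
  have hmain : min 8 a * G ≤ (P.L : ℝ) ^ 2 * S + a * q := by
    have h1 : min 8 a * G ≤ min 8 a * (wj P j * (φ₀ ⬝ᵥ φ₀)) := mul_le_mul_of_nonneg_left hJ hmin.le
    have h2 : wj P j * (min 8 a * (φ₀ ⬝ᵥ φ₀))
        ≤ wj P j * (((P.L : ℝ) ^ lvl P (j + 1)) ^ 2 * D + a * (φ₀ ⬝ᵥ ((Qks P (j + 1) * Qk P (j + 1)) *ᵥ φ₀))) :=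
      mul_le_mul_of_nonneg_left bp hw.le
    have h3 : wj P j * (((P.L : ℝ) ^ lvl P (j + 1)) ^ 2 * D) ≤ (P.L : ℝ) ^ 2 * S := by
      calc wj P j * (((P.L : ℝ) ^ lvl P (j + 1)) ^ 2 * D)
          ≤ wj P j * ((P.L : ℝ) ^ 2 * ((P.L : ℝ) ^ j) ^ 2 * D) :=
            mul_le_mul_of_nonneg_left (mul_le_mul_of_nonneg_right hlv hD0) hw.le
        _ = (P.L : ℝ) ^ 2 * (wj P j * (((P.L : ℝ) ^ j) ^ 2 * D)) := by ring
        _ ≤ (P.L : ℝ) ^ 2 * S := mul_le_mul_of_nonneg_left hSD hL0.le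
    have h4 : wj P j * (((P.L : ℝ) ^ lvl P (j + 1)) ^ 2 * D + a * (φ₀ ⬝ᵥ ((Qks P (j + 1) * Qk P (j + 1)) *ᵥ φ₀)))
        = wj P j * (((P.L : ℝ) ^ lvl P (j + 1)) ^ 2 * D) + a * q := by rw [mul_add, ← comp]; ring
    have h5 : min 8 a * (wj P j * (φ₀ ⬝ᵥ φ₀)) = wj P j * (min 8 a * (φ₀ ⬝ᵥ φ₀)) := by ring
    linarith
  -- N ≤ 2G + 2r
  have hN2 : N ≤ 2 * G + 2 * r := by
    have h := add_dot_self_le g (ψ - g)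
    rw [add_sub_cancel] at h
    have e : (ψ - g) ⬝ᵥ (ψ - g) = r := by
      rw [hr, show ψ - g = -(g - ψ) by abel, neg_dotProduct, dotProduct_neg, neg_neg]
    linarith
  -- the arithmetic
  rw [hE]
  exact arith115 hL0 ha hA hmin hS0 hp0 hr0 hq2 hmain hN2

/-- **(1.15), LOWER BOUND, LEVEL-FREE CONSTANT**: `gamma115u L a · ‖ψ‖² ≤ ⟨ψ, (aL^{−2}Q^*Q + Δ^{(j)})ψ⟩` for all
`j ≥ 1` (a(1 − L^{−2}) < a_j, `B1.ainf_lt_aSeq`). [cite: Balaban1983RegularityDecay, (1.15) p.574] -/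
theorem ineq115_lower_uniform {a msq : ℝ} (ha : 0 < a) (hm : 0 ≤ msq) {j : ℕ} (hj : 1 ≤ j) (ψ : Site P j → ℝ) :
    gamma115u P.L a * (ψ ⬝ᵥ ψ) ≤ ψ ⬝ᵥ (Carg P a msq j *ᵥ ψ) :=
  (mul_le_mul_of_nonneg_right
      (gamma115u_le ha (one_lt_cast_L P) (B1.ainf_lt_aSeq ha (one_lt_cast_L P) j hj)) (dot_self_nonneg ψ)).trans
    (ineq115_lower ha hm hj ψ)

/-- **(1.15), UPPER BOUND, ON THE TORUS**: `⟨ψ, (aL^{−2}Q^*Q + Δ^{(j)})ψ⟩ ≤ (aL^{−2} + a)·‖ψ‖²` (Q^*Q ≤ 1,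
Δ^{(j)} ≤ a_j ≤ a). [cite: Balaban1983RegularityDecay, (1.15) p.574] -/
theorem ineq115_upper {a msq : ℝ} (ha : 0 < a) (hm : 0 ≤ msq) {j : ℕ} (hj : 1 ≤ j) (ψ : Site P j → ℝ) :
    ψ ⬝ᵥ (Carg P a msq j *ᵥ ψ) ≤ (a * ((P.L : ℝ) ^ 2)⁻¹ + a) * (ψ ⬝ᵥ ψ) := by
  have hp := (form_EA_nonneg_le P (sitesPerDir_eq_succ P j) ψ).2
  rw [← QsQ_eq] at hp
  have hD := form_Drs_le ha hm hj ψ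
  have hA := B1.aSeq_le ha (one_lt_cast_L P) j hj
  have hN := dot_self_nonneg ψ
  rw [Carg, Matrix.add_mulVec, dotProduct_add, Matrix.smul_mulVec, dotProduct_smul, smul_eq_mul, add_mul]
  have h1 : a * ((P.L : ℝ) ^ 2)⁻¹ * (ψ ⬝ᵥ ((Qs P j * Q P j) *ᵥ ψ)) ≤ a * ((P.L : ℝ) ^ 2)⁻¹ * (ψ ⬝ᵥ ψ) :=
    mul_le_mul_of_nonneg_left hp (by positivity)
  have h2 : B1.aSeq a P.L j * (ψ ⬝ᵥ ψ) ≤ a * (ψ ⬝ᵥ ψ) := mul_le_mul_of_nonneg_right hA hN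
  linarith

/-- **(1.15) ON THE TORUS** for the concrete scalar tower, both bounds, uniformly in the level `j ≥ 1`, the volume,
the cutoff and m² ≥ 0: `γ₀‖ψ‖² ≤ ⟨ψ, (aL^{−2}Q^*Q + Δ^{(j)})ψ⟩ ≤ γ₁‖ψ‖²` with `γ₀ = gamma115u L a`,
`γ₁ = aL^{−2} + a`. [cite: Balaban1983RegularityDecay, (1.15) p.574] -/
theorem ineq115 {a msq : ℝ} (ha : 0 < a) (hm : 0 ≤ msq) {j : ℕ} (hj : 1 ≤ j) (ψ : Site P j → ℝ) :
    gamma115u P.L a * (ψ ⬝ᵥ ψ) ≤ ψ ⬝ᵥ (Carg P a msq j *ᵥ ψ)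
      ∧ ψ ⬝ᵥ (Carg P a msq j *ᵥ ψ) ≤ (a * ((P.L : ℝ) ^ 2)⁻¹ + a) * (ψ ⬝ᵥ ψ) :=
  ⟨ineq115_lower_uniform ha hm hj ψ, ineq115_upper ha hm hj ψ⟩

/-- `Carg` is symmetric — the first clause of `B4Sect5Torus.Hyp56` for the K2 node. [folklore] -/
theorem Carg_isSymm (a msq : ℝ) (j : ℕ) : (Carg P a msq j).IsSymm := by
  rw [Carg, QsQ_eq]
  exact ((EA_isSymm P _).smul _).add (Drs_isSymm a msq j)

/-- The coercivity clause of `B4Sect5Torus.Hyp56` for `A = Carg`, in its exact shape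
(`γ₀·Σ_p v_p² ≤ Σ_p v_p(Av)_p`). [cite: Balaban1983RegularityDecay, (5.6) p.594] -/
theorem Carg_coercive_sum {a msq : ℝ} (ha : 0 < a) (hm : 0 ≤ msq) {j : ℕ} (hj : 1 ≤ j) (v : Site P j → ℝ) :
    gamma115u P.L a * ∑ p, v p ^ 2 ≤ ∑ p, v p * (Carg P a msq j).mulVec v p := by
  have h := ineq115_lower_uniform ha hm hj v
  simp only [dotProduct, sq] at h ⊢
  exact h

/-- `Carg` has trivial kernel. [folklore] -/
theorem Carg_ker {a msq : ℝ} (ha : 0 < a) (hm : 0 ≤ msq) {j : ℕ} (hj : 1 ≤ j) (ψ : Site P j → ℝ)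
    (h0 : Carg P a msq j *ᵥ ψ = 0) : ψ = 0 := by
  have hγ := gamma115u_pos ha (one_lt_cast_L P)
  have hc := ineq115_lower_uniform (P := P) ha hm hj ψ
  rw [h0, dotProduct_zero] at hc
  exact eq_zero_of_dot_self_nonpos ψ (by nlinarith [dot_self_nonneg ψ])

/-- **`Carg` is invertible** — an independent (coercivity) proof that C^{(j)} of (2.31) exists on the torus (cf.
`B1RG242Torus.C_arg`, B1 p. 611 *"It is so"*). [cite: Balaban1982Higgs1, (2.31) p.611] -/
theorem Carg_isUnit {a msq : ℝ} (ha : 0 < a) (hm : 0 ≤ msq) {j : ℕ} (hj : 1 ≤ j) :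
    IsUnit (Carg P a msq j) := by
  rw [← Matrix.mulVec_injective_iff_isUnit]
  exact B1RG242.mulVec_injective_of_ker fun φ h0 => Carg_ker ha hm hj φ h0

/-- `Carg · Crs = 1`. [folklore] -/
theorem Carg_mul_Crs {a msq : ℝ} (ha : 0 < a) (hm : 0 ≤ msq) {j : ℕ} (hj : 1 ≤ j) :
    Carg P a msq j * Crs P a msq j = 1 := by
  rw [Crs_eq, Matrix.mul_nonsing_inv _ ((Matrix.isUnit_iff_isUnit_det _).mp (Carg_isUnit ha hm hj))]

/-- **C^{(j)} ≥ 0 and C^{(j)} ≤ γ₀^{−1}** on the torus: `0 ≤ ⟨u, Crs u⟩ ≤ gamma115u^{−1}·‖u‖²` (the operator-norm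
consequence of (1.15)). [cite: Balaban1983RegularityDecay, (1.15) p.574] -/
theorem Crs_form_bounds {a msq : ℝ} (ha : 0 < a) (hm : 0 ≤ msq) {j : ℕ} (hj : 1 ≤ j) (u : Site P j → ℝ) :
    0 ≤ u ⬝ᵥ (Crs P a msq j *ᵥ u) ∧ u ⬝ᵥ (Crs P a msq j *ᵥ u) ≤ (gamma115u P.L a)⁻¹ * (u ⬝ᵥ u) := by
  set γ := gamma115u (P.L : ℝ) a with hγdef
  have hγ : 0 < γ := gamma115u_pos ha (one_lt_cast_L P)
  set v := Crs P a msq j *ᵥ u with hv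
  have hu : Carg P a msq j *ᵥ v = u := by
    rw [hv, Matrix.mulVec_mulVec, Carg_mul_Crs ha hm hj, Matrix.one_mulVec]
  have hc := ineq115_lower_uniform (P := P) ha hm hj v
  rw [hu, ← hγdef] at hc
  have hvu : v ⬝ᵥ u = u ⬝ᵥ v := dotProduct_comm v u
  have hvv := dot_self_nonneg v
  refine ⟨?_, ?_⟩
  · calc (0 : ℝ) ≤ γ * (v ⬝ᵥ v) := mul_nonneg hγ.le hvv
      _ ≤ v ⬝ᵥ u := hc
      _ = u ⬝ᵥ v := hvu
  · -- 0 ≤ ‖γv − u‖² = γ²‖v‖² − 2γ⟨v,u⟩ + ‖u‖² and γ‖v‖² ≤ ⟨v,u⟩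
    have hsq := dot_self_nonneg (γ • v - u)
    rw [sub_dotProduct, dotProduct_sub, dotProduct_sub, smul_dotProduct, dotProduct_smul, dotProduct_smul,
      smul_dotProduct, smul_eq_mul, smul_eq_mul, smul_eq_mul, smul_eq_mul, hvu] at hsq
    rw [← hvu, ← div_eq_inv_mul, le_div_iff₀ hγ]
    nlinarith [mul_le_mul_of_nonneg_left hc hγ.le]

end Ineq115

end B4Ineq115Torus

end Literature.MathematicalPhysics.QuantumFieldTheory.Balaban1983to89
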